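/-
Copyright (c) 2026. All rights reserved.
Released under Apache 2.0 license as described in the file LICENSE.
Authors: HodgeCM publication cell (pub-hodgecm), GR lane, seat GR-2 (`pub-hodgecm-own-hyp34`).
-/
import Literature.NumberTheory.Weil1964.ArchFollandFrameGen
import Literature.NumberTheory.Weil1964.ArchMetaplecticLeviSection
import Literature.NumberTheory.Weil1964.ArchSplitRealPlaceSection
import HarnessLib

/-!
# The Folland frame at a real place: the local symplectic group in frame coordinates, and a split real place

Twin of `ArchComplexPlaceRealification` (complex places) for a REAL place `v` with diagonal Gram matrix
`T = diag(t)`, `t_j ≠ 0`, in the Folland frame with scaling `1`: the slice of the archimedean Folland coordinates is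
`follandScale 1 t (a, b) = (a, −t b)` (`ArchFollandTorus`, `ArchFollandFrameTwist.realSlice_archFolland_twist_diagonal`),
an ANTI-symplectic map `((ℝ^ι)², polar β_T) → ((ℝ^ι)², polar β_dot)` (`polar_dotPairing_follandScale_one`).  Hence:

* `rsRealify t M = F ∘ M ∘ F⁻¹ ∈ Sp((ℝ^ι)², β_dot)` for `M ∈ Sp((ℝ^ι)², polar β_T)`, `F = follandScale 1 t`
  (a group homomorphism `rsRealifyHom`; `rsRealify_apply_follandScale`);
* **`rsRealify_leviSp`**: the `β_T`-Levi element `(a, T⁻¹a⁻ᵀT)` goes to Folland's `m(a) = (a, a⁻ᵀ)` — the projection of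
  `MpS.leviGL a` (the sign `−t` of the frame is absorbed: `m(a)` commutes with `(x, y) ↦ (x, −y)`);
* at a real place of `F` SPLIT in `E` (`ArchSplitRealPlaceSection`: `U(swap, T ⊗ 1)(ℝ × ℝ) ↪ Sp(polar β_T)` by
  `toSymplectic`, conjugate by `splitCayley` into the Siegel Levi): `rsCayley = rsRealify (splitCayley)` and
  **`rsRealify_toSymplectic : rsRealify (toSymplectic g) = rsCayley⁻¹ · proj (leviGL g₊) · rsCayley`**, `g₊ = plusGL g`
  — the form in which the type-(ii) block of the archimedean Weil section (`ArchRealSplitPlacesSection.rsPlacesSection`,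
  a `placeLeviSection`) matches the frame dictionary.

Topic `NumberTheory/Weil1964`; KERNEL only: definitions with bodies and theorems; no `def … : Prop`, no named fact,
no `sorry`.  Written for the stage-1 cell `pub-hodgecm` (GR lane); nothing here is a claim of the manuscripts
adjudicated by that cell.

## References
* G. B. Folland, *Harmonic Analysis in Phase Space* (1989), Prop. (1.43), §4.2 (4.24) [Folland1989].
* C. Mœglin, M.-F. Vignéras, J.-L. Waldspurger, LNM 1291 (1987), Chap. 2 II.2, III.1 [MoeglinVignerasWaldspurger1987].
* S. S. Kudla, Israel J. Math. 87 (1994), §3 [Kudla1994].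
-/

set_option autoImplicit false

noncomputable section

open scoped Matrix
open Matrix
open Literature.RepresentationTheory.HeisenbergGroup
open Literature.RepresentationTheory.HeisenbergGroup.SymplecticMatrix
open Literature.Analysis.SegalBargmann
open Literature.NumberTheory.Automorphic Literature.NumberTheory.Automorphic.UnitaryGroup

namespace Literature.NumberTheory.Weil1964

variable {ι : Type} [Fintype ι] [DecidableEq ι] (t : ι → ℝ) (ht : ∀ j, t j ≠ 0)

/-! ## §1 The frame map is anti-symplectic -/

section Frame

omit [Fintype ι] [DecidableEq ι] in
/-- `1 ≠ 0` componentwise (the frame scaling at a split real place). [cite: Folland1989, Prop. (1.43)] -/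
theorem one_ne_zero_pi : ∀ j : ι, (fun _ : ι => (1 : ℝ)) j ≠ 0 := fun _ => one_ne_zero

/-- **`polar β_dot (F x) (F y) = −polar β_{diag t} x y`** for `F = follandScale 1 t`, `F (a, b) = (a, −t b)`.
[cite: Folland1989, Prop. (1.43)] -/
theorem polar_dotPairing_follandScale_one (x y : (ι → ℝ) × (ι → ℝ)) :
    polar (dotPairing ι) (follandScale (fun _ => (1 : ℝ)) t x) (follandScale (fun _ => (1 : ℝ)) t y) =
      -polar (Matrix.toLinearMap₂' ℝ (Matrix.diagonal t)) x y := by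
  simp only [polar_apply, dotPairing_apply, follandScale_apply, Matrix.toLinearMap₂'_apply', dotProduct,
    Matrix.mulVec_diagonal, ← Finset.sum_neg_distrib, div_one, one_mul]
  refine Finset.sum_congr rfl fun j _ => ?_
  ring

include ht in
/-- `det (diag t)` is a unit. [cite: Folland1989, Prop. (1.43)] -/
theorem isUnit_det_diagonal_of_ne_zero : IsUnit (Matrix.diagonal t).det := by
  rw [Matrix.det_diagonal]
  exact (IsUnit.mk0 _ (Finset.prod_ne_zero_iff.2 fun j _ => ht j))

/-- **`rsRealify t M = F ∘ M ∘ F⁻¹ ∈ Sp((ℝ^ι)², β_dot)`** for `M ∈ Sp((ℝ^ι)², polar β_{diag t})`, `F = follandScale 1 t`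
(anti-symplectic, so conjugation preserves symplecticity). [cite: MoeglinVignerasWaldspurger1987, Chap. 2 II.2] -/
def rsRealify (M : symplecticGroup (polar (Matrix.toLinearMap₂' ℝ (Matrix.diagonal t)))) :
    symplecticGroup (polar (dotPairing ι)) :=
  ⟨(follandScaleEquiv (fun _ => (1 : ℝ)) t one_ne_zero_pi ht).symm ≪≫ₗ
      (M : ((ι → ℝ) × (ι → ℝ)) ≃ₗ[ℝ] ((ι → ℝ) × (ι → ℝ))) ≪≫ₗ follandScaleEquiv (fun _ => (1 : ℝ)) t one_ne_zero_pi ht, by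
    rw [mem_symplecticGroup]
    intro P Q
    obtain ⟨x, rfl⟩ := (follandScaleEquiv (fun _ => (1 : ℝ)) t one_ne_zero_pi ht).surjective P
    obtain ⟨y, rfl⟩ := (follandScaleEquiv (fun _ => (1 : ℝ)) t one_ne_zero_pi ht).surjective Q
    have hM := (mem_symplecticGroup _ _).mp M.2 x y
    simp only [LinearEquiv.trans_apply, LinearEquiv.symm_apply_apply]
    rw [coe_follandScaleEquiv, polar_dotPairing_follandScale_one, polar_dotPairing_follandScale_one,
      polar_dotPairing_follandScale_one, polar_dotPairing_follandScale_one]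
    linear_combination -hM⟩

/-- `rsRealify` on vectors: `F (M (F⁻¹ pq))`. [cite: MoeglinVignerasWaldspurger1987, Chap. 2 II.2] -/
theorem coe_rsRealify_apply (M : symplecticGroup (polar (Matrix.toLinearMap₂' ℝ (Matrix.diagonal t))))
    (pq : (ι → ℝ) × (ι → ℝ)) :
    ((rsRealify t ht M : symplecticGroup (polar (dotPairing ι))) : ((ι → ℝ) × (ι → ℝ)) ≃ₗ[ℝ] ((ι → ℝ) × (ι → ℝ))) pq =
      follandScale (fun _ => (1 : ℝ)) t
        ((M : ((ι → ℝ) × (ι → ℝ)) ≃ₗ[ℝ] ((ι → ℝ) × (ι → ℝ))) ((follandScaleEquiv (fun _ => (1 : ℝ)) t one_ne_zero_pi ht).symm pq)) :=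
  rfl

/-- **`rsRealify M (F x) = F (M x)`**. [cite: MoeglinVignerasWaldspurger1987, Chap. 2 II.2] -/
theorem rsRealify_apply_follandScale (M : symplecticGroup (polar (Matrix.toLinearMap₂' ℝ (Matrix.diagonal t))))
    (x : (ι → ℝ) × (ι → ℝ)) :
    ((rsRealify t ht M : symplecticGroup (polar (dotPairing ι))) : ((ι → ℝ) × (ι → ℝ)) ≃ₗ[ℝ] ((ι → ℝ) × (ι → ℝ)))
        (follandScale (fun _ => (1 : ℝ)) t x) =
      follandScale (fun _ => (1 : ℝ)) t ((M : ((ι → ℝ) × (ι → ℝ)) ≃ₗ[ℝ] ((ι → ℝ) × (ι → ℝ))) x) := by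
  rw [coe_rsRealify_apply, ← coe_follandScaleEquiv _ t one_ne_zero_pi ht, LinearEquiv.symm_apply_apply]

/-- **`rsRealify` is a group homomorphism.** [cite: MoeglinVignerasWaldspurger1987, Chap. 2 II.2] -/
def rsRealifyHom : symplecticGroup (polar (Matrix.toLinearMap₂' ℝ (Matrix.diagonal t))) →* symplecticGroup (polar (dotPairing ι)) where
  toFun := rsRealify t ht
  map_one' := Subtype.ext (LinearEquiv.ext fun pq => by
    rw [coe_rsRealify_apply, Subgroup.coe_one, LinearEquiv.coe_one, id, ← coe_follandScaleEquiv _ t one_ne_zero_pi ht,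
      LinearEquiv.apply_symm_apply, Subgroup.coe_one, LinearEquiv.coe_one, id])
  map_mul' M N := Subtype.ext (LinearEquiv.ext fun pq => by
    rw [Subgroup.coe_mul, LinearEquiv.mul_apply, coe_rsRealify_apply, coe_rsRealify_apply, coe_rsRealify_apply,
      ← coe_follandScaleEquiv _ t one_ne_zero_pi ht, LinearEquiv.symm_apply_apply, Subgroup.coe_mul, LinearEquiv.mul_apply])

/-- unfolding. [cite: MoeglinVignerasWaldspurger1987, Chap. 2 II.2] -/
@[simp] theorem rsRealifyHom_apply (M : symplecticGroup (polar (Matrix.toLinearMap₂' ℝ (Matrix.diagonal t)))) :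
    rsRealifyHom t ht M = rsRealify t ht M := rfl

end Frame

/-! ## §2 The `β_T`-Levi goes to Folland's Levi -/

section Levi

omit [Fintype ι] [DecidableEq ι] in
/-- `F⁻¹ (p, q) = (p, −t⁻¹ q)`. [cite: Folland1989, Prop. (1.43)] -/
theorem follandScaleEquiv_one_symm_apply (pq : (ι → ℝ) × (ι → ℝ)) :
    (follandScaleEquiv (fun _ => (1 : ℝ)) t one_ne_zero_pi ht).symm pq = (pq.1, fun j => -(t j)⁻¹ * pq.2 j) := by
  apply (follandScaleEquiv (fun _ => (1 : ℝ)) t one_ne_zero_pi ht).injective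
  rw [LinearEquiv.apply_symm_apply, coe_follandScaleEquiv, follandScale_apply]
  refine Prod.ext (funext fun j => by simp) (funext fun j => ?_)
  have h := ht j
  field_simp

/-- **THE `β_T`-LEVI GOES TO FOLLAND'S LEVI**: `rsRealify t (m_T(a, T⁻¹a⁻ᵀT)) = m(a, a⁻ᵀ) = proj (leviGL a)` (`T = diag t`).
[cite: Folland1989, §4.2 (4.24); MoeglinVignerasWaldspurger1987, Chap. 2 II.2] -/
theorem rsRealify_leviSp (g : GL ι ℝ) :
    rsRealify t ht (leviSp (Matrix.toLinearMap₂' ℝ (Matrix.diagonal t)) (glEquiv g)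
        (leviDual (Matrix.diagonal t) (isUnit_det_diagonal_of_ne_zero t ht) g)
        (leviDual_compat (Matrix.diagonal t) (isUnit_det_diagonal_of_ne_zero t ht) g)) =
      MpS.proj (MpS.leviGL g) := by
  apply Subtype.ext
  apply LinearEquiv.ext
  intro pq
  rw [coe_rsRealify_apply, follandScaleEquiv_one_symm_apply, coe_leviSp_apply, glEquiv_apply, leviDual_apply,
    MpS.coe_proj_leviGL_apply, follandScale_apply]
  refine Prod.ext (funext fun i => by simp) (funext fun i => ?_)
  -- second component: `-t_i · ((T⁻¹ g⁻ᵀ T) (−t⁻¹ q))_i = (g⁻ᵀ q)_i` for `T = diag t`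
  have hTinv : (Matrix.diagonal t)⁻¹ = Matrix.diagonal fun j => (t j)⁻¹ := by
    refine Matrix.inv_eq_left_inv ?_
    rw [Matrix.diagonal_mul_diagonal, ← Matrix.diagonal_one]
    exact congrArg Matrix.diagonal (funext fun j => inv_mul_cancel₀ (ht j))
  have hq : Matrix.diagonal t *ᵥ (fun j => -(t j)⁻¹ * pq.2 j) = -pq.2 := by
    funext j
    rw [Matrix.mulVec_diagonal, Pi.neg_apply]
    field_simp [ht j]
  simp only
  rw [hTinv, ← Matrix.mulVec_mulVec, ← Matrix.mulVec_mulVec, hq, Matrix.mulVec_neg, Matrix.mulVec_diagonal, Pi.neg_apply,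
    div_one]
  field_simp [ht i]

end Levi

/-! ## §3 A unitary group `U(swap, T ⊗ 1)(ℝ × ℝ)` in the frame: a conjugate of Folland's Levi -/

section Unitary

variable {s : ℝ} (hs : s ≠ 0)

/-- **the split Cayley element in the frame** `κ = rsRealify t (splitCayley)` of `Sp((ℝ^ι)², β_dot)`.
[cite: MoeglinVignerasWaldspurger1987, Chap. 2 III.1] -/
def rsCayley : symplecticGroup (polar (dotPairing ι)) :=
  rsRealify t ht (IsQuadraticCoordinates.splitCayley ι (Matrix.diagonal t) (two_mul_mul_inv_two_mul s hs)
    (Matrix.isSymm_diagonal t))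

/-- **`U(swap, diag t ⊗ 1)(ℝ × ℝ)` IN THE FRAME IS A CONJUGATE OF FOLLAND'S LEVI**: for `g ∈ U(swap, T ⊗ 1)`,
`rsRealify t (toSymplectic g) = κ⁻¹ · proj (leviGL g₊) · κ` with `κ = rsCayley` and `g₊ = plusGL g`
(`UnitaryGroupSymplecticSplitLevi.splitCayley_conj_toSymplectic` in the frame, by §1–§2).
[cite: Kudla1994, §3; MoeglinVignerasWaldspurger1987, Chap. 2 III.1] -/
theorem rsRealify_toSymplectic {H : Matrix ι ι (ℝ × ℝ)} (hH : H = (Matrix.diagonal t).map ((RingHom.id ℝ).prod (RingHom.id ℝ)))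
    (g : unitaryGroupOfForm (RingEquiv.prodComm : ℝ × ℝ ≃+* ℝ × ℝ).toRingHom H) :
    rsRealify t ht ((isQuadraticCoordinates_splitReal s hs).toSymplectic ι (Matrix.isSymm_diagonal t) swap_diag
        (swap_delta s) hH g) =
      (rsCayley t ht hs)⁻¹ * MpS.proj (MpS.leviGL ((isQuadraticCoordinates_splitReal s hs).plusGL rfl ι g)) *
        rsCayley t ht hs := by
  have key := (isQuadraticCoordinates_splitReal s hs).splitCayley_conj_toSymplectic rfl ι
    (isUnit_det_diagonal_of_ne_zero t ht) (two_mul_mul_inv_two_mul s hs) swap_diag (swap_delta s) hH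
    (Matrix.isSymm_diagonal t) g
  have h1 : (isQuadraticCoordinates_splitReal s hs).toSymplectic ι (Matrix.isSymm_diagonal t) swap_diag (swap_delta s) hH g =
      (IsQuadraticCoordinates.splitCayley ι (Matrix.diagonal t) (two_mul_mul_inv_two_mul s hs) (Matrix.isSymm_diagonal t))⁻¹ *
        leviSp (Matrix.toLinearMap₂' ℝ (Matrix.diagonal t))
          (glEquiv ((isQuadraticCoordinates_splitReal s hs).plusGL rfl ι g))
          (leviDual (Matrix.diagonal t) (isUnit_det_diagonal_of_ne_zero t ht) ((isQuadraticCoordinates_splitReal s hs).plusGL rfl ι g))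
          (leviDual_compat (Matrix.diagonal t) (isUnit_det_diagonal_of_ne_zero t ht) _) *
        IsQuadraticCoordinates.splitCayley ι (Matrix.diagonal t) (two_mul_mul_inv_two_mul s hs) (Matrix.isSymm_diagonal t) := by
    rw [← key]; group
  rw [h1, ← rsRealifyHom_apply, map_mul, map_mul, map_inv, rsRealifyHom_apply, rsRealifyHom_apply, rsRealify_leviSp]
  rfl

end Unitary

end Literature.NumberTheory.Weil1964

end
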